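import Summits.Ventures.HodgeRepro2.T5SU11ResolventSymmetricClass
import Summits.Ventures.HodgeRepro2.T5SU11ResolventNeumann

/-!
# The powers of the resolvent are symmetric on the class: `⟨f, (G^I_λ)ⁿ h⟩ = ⟨(G^I_λ)ⁿ f, h⟩`

Row 523's symmetry `⟨G^I_λ g, h⟩ = ⟨g, G^I_λ h⟩` of the resolvent on the class of continuous sources bounded near `0`
and decaying at a rate `> 1`, moved across the resolvents one at a time (the iterates stay in the class at every rate
`< min(ε, λ)`, row 503):

* `inner_iterate_symm` — **`∫ f · (G^I_λ)ⁿ h sinh 2r = ∫ (G^I_λ)ⁿ f · h sinh 2r`** for class sources `f, h` of rates `> 1`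
  (the induction is generalised over `f`: the left source becomes `G^I_λ f` at each step);
* `inner_iterate_iterate` — **`⟨(G^I_λ)ᵐ f, (G^I_λ)ⁿ h⟩ = ⟨(G^I_λ)^{m+n} f, h⟩`**;
* `inner_iterate_comm` — **`⟨(G^I_λ)ᵐ f, (G^I_λ)ⁿ h⟩ = ⟨(G^I_λ)ⁿ f, (G^I_λ)ᵐ h⟩`** — the powers of the resolvent are
  self-adjoint for the pairing `⟨·,·⟩` with the weight `sinh 2r`.

Row 582's symmetry of the composed kernels is the case `h = K_λ(·, s)`.

Nothing is claimed about (N).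

Blind lane: Mathlib + the HodgeRepro2 prefix only; no sorry; axioms ⊆ {propext, Classical.choice,
Quot.sound}.
-/

namespace Summit.Ventures.HodgeRepro2.T5SU11ResolventIterateSymmetric

open Filter Topology MeasureTheory
open Set (Ioi Ioc)
open T5SU11Cartan T5SU11SphericalFunction T5SU11SphericalDecay T5SU11RadialGreenKernel T5SU11RadialGreenImproper
  T5SU11RadialGreenImproperStable T5SU11ResolventSymmetricClass T5SU11ResolventNeumann

section measure

variable [MeasurableSpace Circle] [BorelSpace Circle]

variable {lam : ℝ} (hlam : 1 < lam)
  {h : ℝ → ℝ} (hh : ContinuousOn h (Ioi 0))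
  {M' : ℝ} (hM' : ∀ s ∈ Ioc (0 : ℝ) 1, |h s| ≤ M') (hM'0 : 0 ≤ M')
  {ε' C' s₀' : ℝ} (hε' : 2 - lam < ε') (hε'1 : 1 < ε')
  (hC' : ∀ s, s₀' ≤ s → |h s| ≤ C' * Real.exp (-ε' * s))

include hlam hh hM' hM'0 hε' hε'1 hC' in
/-- **The powers of the resolvent are symmetric on the class**: for every source `f` of the class at a rate `ε > 1`
and `h` of the class at a rate `ε' > 1`, `∫ f · (G^I_λ)ⁿ h sinh 2r = ∫ (G^I_λ)ⁿ f · h sinh 2r`. -/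
theorem inner_iterate_symm (n : ℕ) :
    ∀ (f : ℝ → ℝ) (M ε C s₀ : ℝ), ContinuousOn f (Ioi 0) → (∀ r ∈ Ioc (0 : ℝ) 1, |f r| ≤ M) → 0 ≤ M →
      2 - lam < ε → 1 < ε → (∀ r, s₀ ≤ r → |f r| ≤ C * Real.exp (-ε * r)) →
      ∫ r in Ioi 0, f r * ((greenSolI (fun t => sph lam (hyp t)) (sphDecay lam))^[n] h) r * Real.sinh (2 * r)
        = ∫ r in Ioi 0, ((greenSolI (fun t => sph lam (hyp t)) (sphDecay lam))^[n] f) r * h r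
          * Real.sinh (2 * r) := by
  induction n with
  | zero => intro f M ε C s₀ _ _ _ _ _ _; rfl
  | succ n ih =>
    intro f M ε C s₀ hf hM hM0 hε hε1 hC
    -- the class data of `(G^I_λ)ⁿ h` at the rate `(1 + min(ε', λ))/2 ∈ (1, min(ε', λ))` (row 503)
    have hmin' : 1 < min ε' lam := lt_min hε'1 hlam
    obtain ⟨hcs, ⟨Ms', hMs'0, hMs'⟩, hds⟩ := iterate_class (lam₂ := lam) hlam hh hM' hM'0 hε' hC' n
    obtain ⟨Ks, Ts, _, _, hKs⟩ := hds ((1 + min ε' lam) / 2) (by linarith)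
    -- the class data of `G^I_λ f` at the rate `(1 + min(ε, λ))/2 ∈ (1, min(ε, λ))` (row 499)
    have hmin : 1 < min ε lam := lt_min hε1 hlam
    have hcf := continuousOn_greenSolI hlam hf hM hM0 hε hC
    obtain ⟨Mf', hMf'0, hMf'⟩ := exists_abs_greenSolI_le_of_le_one hlam hf hM hM0 hε hC
    obtain ⟨Kf, Tf, _, _, hKf⟩ := exists_abs_greenSolI_le_exp hlam hf hM hM0 hε hC
      (ε' := (1 + min ε lam) / 2) (by linarith)
    have hεf : 2 - lam < (1 + min ε lam) / 2 := by linarith [min_le_right ε lam]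
    have hεf1 : 1 < (1 + min ε lam) / 2 := by linarith
    -- one resolvent across: `⟨f, G (Gⁿ h)⟩ = ⟨G f, Gⁿ h⟩` (row 523)
    have hsym := inner_greenSolI_symm hlam hf hM hM0 hC hcs hMs' hMs'0 hKs hε1
      (by linarith : 1 < (1 + min ε' lam) / 2)
    rw [Function.iterate_succ_apply', ← hsym]
    -- the induction hypothesis on `G^I_λ f`, and `(G^I_λ)^{n+1} f = (G^I_λ)ⁿ (G^I_λ f)`
    rw [Function.iterate_succ_apply]
    exact ih (greenSolI (fun t => sph lam (hyp t)) (sphDecay lam) f) Mf' ((1 + min ε lam) / 2) Kf Tf hcf hMf' hMf'0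
      hεf hεf1 hKf

variable {f : ℝ → ℝ} (hf : ContinuousOn f (Ioi 0))
  {M : ℝ} (hM : ∀ r ∈ Ioc (0 : ℝ) 1, |f r| ≤ M) (hM0 : 0 ≤ M)
  {ε C s₀ : ℝ} (hε : 2 - lam < ε) (hε1 : 1 < ε)
  (hC : ∀ r, s₀ ≤ r → |f r| ≤ C * Real.exp (-ε * r))

include hlam hf hM hM0 hε hε1 hC hh hM' hM'0 hε' hε'1 hC' in
/-- **`⟨(G^I_λ)ᵐ f, (G^I_λ)ⁿ h⟩ = ⟨(G^I_λ)^{m+n} f, h⟩`** for class sources `f, h` of rates `> 1`. -/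
theorem inner_iterate_iterate (m n : ℕ) :
    ∫ r in Ioi 0, ((greenSolI (fun t => sph lam (hyp t)) (sphDecay lam))^[m] f) r
        * ((greenSolI (fun t => sph lam (hyp t)) (sphDecay lam))^[n] h) r * Real.sinh (2 * r)
      = ∫ r in Ioi 0, ((greenSolI (fun t => sph lam (hyp t)) (sphDecay lam))^[n + m] f) r * h r
          * Real.sinh (2 * r) := by
  -- the class data of `(G^I_λ)ᵐ f` at the rate `(1 + min(ε, λ))/2 ∈ (1, min(ε, λ))` (row 503)
  have hmin : 1 < min ε lam := lt_min hε1 hlam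
  obtain ⟨hcm, ⟨Mm, hMm0, hMm⟩, hdm⟩ := iterate_class (lam₂ := lam) hlam hf hM hM0 hε hC m
  obtain ⟨Km, Tm, _, _, hKm⟩ := hdm ((1 + min ε lam) / 2) (by linarith)
  have hεm : 2 - lam < (1 + min ε lam) / 2 := by linarith [min_le_right ε lam]
  have hεm1 : 1 < (1 + min ε lam) / 2 := by linarith
  rw [inner_iterate_symm hlam hh hM' hM'0 hε' hε'1 hC' n _ Mm ((1 + min ε lam) / 2) Km Tm hcm hMm hMm0 hεm hεm1 hKm,
    Function.iterate_add_apply]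

include hlam hf hM hM0 hε hε1 hC hh hM' hM'0 hε' hε'1 hC' in
/-- **The powers of the resolvent are self-adjoint**: `⟨(G^I_λ)ᵐ f, (G^I_λ)ⁿ h⟩ = ⟨(G^I_λ)ⁿ f, (G^I_λ)ᵐ h⟩` for class
sources `f, h` of rates `> 1`. -/
theorem inner_iterate_comm (m n : ℕ) :
    ∫ r in Ioi 0, ((greenSolI (fun t => sph lam (hyp t)) (sphDecay lam))^[m] f) r
        * ((greenSolI (fun t => sph lam (hyp t)) (sphDecay lam))^[n] h) r * Real.sinh (2 * r)
      = ∫ r in Ioi 0, ((greenSolI (fun t => sph lam (hyp t)) (sphDecay lam))^[n] f) r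
          * ((greenSolI (fun t => sph lam (hyp t)) (sphDecay lam))^[m] h) r * Real.sinh (2 * r) := by
  rw [inner_iterate_iterate hlam hh hM' hM'0 hε' hε'1 hC' hf hM hM0 hε hε1 hC m n,
    inner_iterate_iterate hlam hh hM' hM'0 hε' hε'1 hC' hf hM hM0 hε hε1 hC n m, Nat.add_comm]

end measure

end Summit.Ventures.HodgeRepro2.T5SU11ResolventIterateSymmetric
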